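import Literature.AlgebraicGeometry.HodgeTheory.CurveTimesSimpleSurfaceStablyNondegenerate
import Literature.AlgebraicGeometry.HodgeTheory.EllipticCurvesProductsStablyNondegenerate
import Literature.AlgebraicGeometry.Pohlmann1968.HodgeClassesProductSpanCMProductsSlots
import Literature.AlgebraicGeometry.Pohlmann1968.SimpleCMAbelianVarietyPowersDivisorGenerated
import Literature.AlgebraicGeometry.Pohlmann1968.CMFamilyRankSlots
import Literature.AlgebraicGeometry.Milne1999.CMSimpleIsogenousCMTyped
import Literature.AlgebraicGeometry.Milne1999.CMHodgeHypothesisFromCMTypedProducts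
import Literature.AlgebraicGeometry.ComplexMultiplication.SimpleIffPrimitiveCMType
import Literature.NumberTheory.ComplexMultiplication.CMTypeRankForeignQuadraticSlot
import Literature.NumberTheory.ComplexMultiplication.CMTypeRankCommonConstituent
import Literature.NumberTheory.ComplexMultiplication.CMTypeDictionaryGroupLevel
import Literature.NumberTheory.ComplexMultiplication.QuarticCMTypes
import HarnessLib

/-!
# A CM elliptic curve times a SIMPLE CM abelian surface is stably nondegenerate (Moonen–Zarhin 1999, Prop. (3.8) and (5.2)) — PROVED; hence every elliptic curve times every abelian surface is stably nondegenerate (the last `E × S` row of Thm. 0.1 (4) in dimension 3)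

Family `hodge`, layer `Literature/AlgebraicGeometry/HodgeTheory`. Research context: cell `pub-hodge-ring2`
(HONEST FRAMING: research route conditional on HC_CM; not a corollary; Q11.4-sentence-2 already refuted in
dim ≥ 3), Literature lane (lit seat, generation 53, programme R19 «`E_k × S`, `S` a simple CM surface» and R20
«every abelian threefold»). Theorems only: no definition, no named fact, no `sorry`; nothing here uses HC_CM —
the CM hypothesis of the cell is NOT needed for this row: §4 is exactly the displayed hypothesis `hR19` of
`AbelianThreefoldsStablyNondegenerate.isStablyNondegenerate_of_dim_eq_three_of` (every complex abelian threefold is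
stably nondegenerate GIVEN this row), which the sequel discharges by name.

PUBLISHED STATEMENT AND PROOF. Moonen–Zarhin, Math. Ann. 315 (1999) [corpus: paper:arxiv-math_9901113]:
Prop. (3.8) (p. 7) «Let `X` be an abelian variety and let `E` be an elliptic curve, both over `ℂ`. Suppose
`Hom(E,X) = 0`. Then either `Hg(X × E) = Hg(X) × Hg(E)` or `End⁰(E) = k` is an imaginary quadratic field such that
there exists an embedding of `k` into the center of `End⁰(X)`»; (5.2) (p. 8) «Suppose `g = 3`. Suppose also that
`X` decomposes, up to isogeny, as a product `X ∼ X₁ × X₂` of an elliptic curve `X₁` and a simple abelian surface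
`X₂`. Then the center of `End⁰(X₂)` does not contain an imaginary quadratic field. By Proposition (3.8) it follows
that `Hg(X) = Hg(X₁) × Hg(X₂)`. […] for every complex abelian variety `X` of dimension `≤ 3` we have
`Hg(X) = Sp_D(V,φ)` and condition (D) in (2.3) is satisfied»; Thm. 0.1 (4) (p. 1) «`B•(Xⁿ) = D•(Xⁿ)` for all `n`».
For `X₂ = S` a simple surface OF CM TYPE with (quartic) CM field `K = End⁰(S)` the mechanism of (3.8) —
Cor. (3.9)'s proof, Gordon's §3 Theorem (Imai, Murty) — is the tree's FOREIGN-SLOT engine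
(`NumberTheory/ComplexMultiplication/CMTypeRankForeignQuadraticSlot`): if `k ↪̸ K` the stabiliser of `Hom(k,ℂ)`
in `Aut(ℂ)` is transitive on `Hom(K,ℂ)`, so `ℚ^{Hom(K,ℂ)}` carries no eigenvector for the quadratic character of
`k`, the character modules of `Hg(E)` and `Hg(S)` have no common constituent
(`CMTypeRankCommonConstituent.pairwise_of_eigenvector`), and the rank of the Hodge torus of `E × S` is additive
(`typeRank_sigmaType_add_card_eq_of_pairwise`: `Hg(E × S) = Hg(E) × Hg(S)`); rank additivity gives the
product-span property on ALL `E^{N+1} × S^{N+1}` (Moonen–Zarhin (3.1) ⟸ for CM products, the tree's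
`Pohlmann1968.hodgeClassesProductSpan_of_isIsogenous_biproduct_slots_of_typeRank_add`), and with condition (D) for
`E` and for `S` (tree) condition (D) for `E × S` (`isStablyNondegenerate_prod_of_forall_productSpan_powSucc`).  The
field-theoretic input «the center of `End⁰(X₂)` does not contain an imaginary quadratic field» is §3: an embedding
`k ↪ K` makes the induced type `{σ | σ|_k ∈ Φ_k}` of the quartic CM field `K` imprimitive
(`exists_ne_of_inducedCMType`), so — primitivity of a quartic CM type depending on the field only, Shimura §8.4 (2),
the tree's `isPrimitive_iff_isPrimitive` — NO CM type of `K` is primitive and no abelian surface with CM by `K` is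
simple (Shimura §8.2 Prop. 26, the tree's `not_isSimple_of_isCMTypeRealisation_of_not_isPrimitive`).

RESULTS.
* §1 `comp_smul_eq_sign_smul_of_finrank_eq_two` — on a two-element slot `Hom(k, ℂ) = {u₀, ū₀}` the antisymmetric
  span is isotypic for the sign character; with the foreign-slot engine (inside §2): an imaginary quadratic slot `k`
  FOREIGN to `K` (`IsEmpty (k →+* K)`) has no common constituent with the `K`-slot.
* §2 `typeRank_sum_add_one_eq_of_finrank_eq_two_of_isEmpty` — rank additivity `rank(Σ_k ⊔ Σ_K) + 1 =
  rank Σ_k + rank Σ_K` (`Hg(A_k × A_K) = Hg(A_k) × Hg(A_K)`) for ANY CM types of `k` (quadratic) and `K ⊉ k`.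
* §3 `not_isSimple_of_isCMTypeRealisation_of_ringHom`, `isEmpty_ringHom_of_isSimple_of_isCMTypeRealisation` —
  a simple abelian surface with CM by the quartic field `K` forces `k ↪̸ K` for every quadratic CM field `k`.
* §4 `hodgeClassesProductSpan_powSucc_cmCurve_powSucc_of_isSimple_surface_of_isOfCMType` and
  **`isStablyNondegenerate_cmCurve_prod_of_isSimple_surface_of_isOfCMType (hE : E.dim = 1) (hEcm : IsOfCMType E)
  (hS : S.IsSimple) (hS2 : S.dim = 2) (hScm : IsOfCMType S) : IsStablyNondegenerate (E.prod S)`** — the row R19.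
* §5 `isStablyNondegenerate_curve_prod_simple_surface (hE : E.dim = 1) (hS : S.IsSimple) (hS2 : S.dim = 2)` (with
  the tree's `…_of_not_and_isOfCMType`, programmes R16/R15) and **`isStablyNondegenerate_curve_prod_surface
  (hE : E.dim = 1) (hS2 : S.dim = 2)`** — EVERY complex elliptic curve times EVERY complex abelian surface is stably
  nondegenerate (`S` not simple: the tree's `isStablyNondegenerate_curve_prod_surface_of_not_isSimple`).

## References
* [MoonenZarhin1999LowDim] B. Moonen, Yu. Zarhin, Math. Ann. 315 (1999) 711–733: Thm. 0.1 (4), §3 (3.1), Prop.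
  (3.8), Cor. (3.9), §4, (5.2) [corpus: paper:arxiv-math_9901113 pp. 1, 6–8]. [cite: MoonenZarhin1999LowDim, Prop. (3.8) and (5.2)]
* [Gordon1999HodgeAVSurvey] B. B. Gordon, *A survey of the Hodge conjecture for abelian varieties*, §3 Theorem
  (Imai, Murty) with proof; 7.5–7.7. [cite: Gordon1999HodgeAVSurvey, §3 Theorem]
* [Shimura1998] G. Shimura, *Abelian Varieties with Complex Multiplication and Modular Functions* (1998), §8.2
  Prop. 26, §8.4 Example (2)(A)–(C). [cite: Shimura1998, §8.4 Example (2)]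
* [vanGeemen1994HodgeAV] B. van Geemen, LNM 1594 (1994), §2.4, Lemma 3.7, Thm. 4.3. [cite: vanGeemen1994HodgeAV, Lemma 3.7]
-/

noncomputable section

open CategoryTheory CategoryTheory.Limits Module NumberField

namespace Literature.AlgebraicGeometry.HodgeTheory

open Literature.NumberTheory.ComplexMultiplication
open Literature.AlgebraicGeometry.Motives (AbelianVariety CMType)
open Literature.AlgebraicGeometry.Motives.AbelianVariety
open Literature.AlgebraicGeometry.ComplexMultiplication (IsCMTypeRealisation isPrimitive_ringEquiv_complex_iff
  not_isSimple_of_isCMTypeRealisation_of_not_isPrimitive)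
open Literature.AlgebraicGeometry.Pohlmann1968
open Literature.AlgebraicGeometry.Milne1999
open Literature.Barriers.HodgeConjecture

/-! ### §1 The sign character of a two-element slot -/

section ForeignSlot

variable {I : Type} {K : I → Type} [∀ i, Field (K i)] [∀ i, NumberField (K i)] [∀ i, IsCMField (K i)]

open scoped Classical in
/-- **The sign character of a two-element slot.**  If `[K_a : ℚ] = 2` (so `Hom(K_a, ℂ) = {u₀, ū₀}`), every
`f` in Shimura's antisymmetric span `U(Φ_a)` (`f(ū₀) = −f(u₀)`) is an eigenvector for the quadratic character
`χ(g) = +1` if `g u₀ = u₀`, `−1` otherwise: `f ∘ g = χ(g) f` — the character module of the rank-one torus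
`Hg(E) = U_k` of a CM elliptic curve. [cite: MoonenZarhin1999LowDim, Cor. (3.9) (proof) and Prop. (3.8)]
[cite: Gordon1999HodgeAVSurvey, §3 Theorem (proof)] -/
theorem comp_smul_eq_sign_smul_of_finrank_eq_two (Φ : ∀ i, CMType (K i)) {a : I}
    (h2 : Module.finrank ℚ (K a) = 2) (u₀ : K a →+* ℂ) {f : (K a →+* ℂ) → ℚ}
    (hf : f ∈ antiSpan (ℂ ≃+* ℂ) (Φ a).1) (g : ℂ ≃+* ℂ) :
    (fun x => f (g • x)) = (if g • u₀ = u₀ then (1 : ℚ) else -1) • f := by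
  classical
  have hCM := isCMTypeWith_conj (Φ a)
  have hne : (starRingAut : ℂ ≃+* ℂ) • u₀ ≠ u₀ := hCM.rho_smul_ne u₀
  -- every embedding of the quadratic field is `u₀` or `ū₀`
  have hall : ∀ x : K a →+* ℂ, x = u₀ ∨ x = (starRingAut : ℂ ≃+* ℂ) • u₀ := by
    intro x
    have hcard : ({u₀, (starRingAut : ℂ ≃+* ℂ) • u₀} : Finset (K a →+* ℂ)).card =
        Fintype.card (K a →+* ℂ) := by
      rw [Finset.card_pair hne.symm, Embeddings.card, h2]
    have hx : x ∈ ({u₀, (starRingAut : ℂ ≃+* ℂ) • u₀} : Finset (K a →+* ℂ)) := by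
      rw [Finset.eq_univ_of_card _ hcard]
      exact Finset.mem_univ x
    simpa only [Finset.mem_insert, Finset.mem_singleton] using hx
  have hanti : ∀ x, f ((starRingAut : ℂ ≃+* ℂ) • x) = -f x := fun x =>
    apply_rho_smul_of_mem_antiSpan hCM hf x
  by_cases hg : g • u₀ = u₀
  · rw [if_pos hg, one_smul]
    have hfix : ∀ x : K a →+* ℂ, g • x = x := by
      intro x
      rcases hall x with rfl | rfl
      · exact hg
      · rw [hCM.comm, hg]
    funext x
    rw [hfix]
  · rw [if_neg hg]
    have hgu : g • u₀ = (starRingAut : ℂ ≃+* ℂ) • u₀ := (hall (g • u₀)).resolve_left hg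
    have hgu' : g • (starRingAut : ℂ ≃+* ℂ) • u₀ = u₀ := by rw [hCM.comm, hgu, hCM.invol]
    funext x
    simp only [Pi.smul_apply, smul_eq_mul, neg_mul, one_mul]
    rcases hall x with rfl | rfl
    · rw [hgu, hanti]
    · rw [hgu', hanti, neg_neg]

end ForeignSlot

/-! ### §2 Rank additivity for the pair (quadratic `k`, `K ⊉ k`): `Hg(A_k × A_K) = Hg(A_k) × Hg(A_K)` -/

section RankAdditivity

variable {k K : Type} [Field k] [NumberField k] [IsCMField k] [Field K] [NumberField K] [IsCMField K]

/-- **Rank additivity for a quadratic CM field `k` and a CM field `K` in which `k` does not embed**, in the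
two-block form consumed by `Pohlmann1968.hodgeClassesProductSpan_of_isIsogenous_biproduct_slots_of_typeRank_add`
(one-member families over `Fin 1`): `rank(Σ_k ⊔ Σ_K) + 1 = rank Σ_k + rank Σ_K` for ARBITRARY CM types `Φ_k` of `k`
and `Φ_K` of `K` — on Hodge groups `Hg(A_k × A_K) = Hg(A_k) × Hg(A_K)` (Moonen–Zarhin Prop. (3.8) for `X` of CM
type: no embedding of `k` into `End⁰(X) = K` ⟹ the Hodge group of the product splits).  Proof: the glued family
over `Fin 1 ⊕ Fin 1` satisfies the pairwise «no common constituent» criterion (§1), hence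
`typeRank_sigmaType_add_card_eq_of_pairwise`; the two index bookkeepings are exchanged along equivariant maps
(`typeRank_preimage_eq`, `typeRank_preimage_eq_of_surjective`). [cite: MoonenZarhin1999LowDim, Prop. (3.8) and §3 (3.1)]
[cite: Gordon1999HodgeAVSurvey, §3 Theorem (1)] -/
theorem typeRank_sum_add_one_eq_of_finrank_eq_two_of_isEmpty (Φk : CMType k) (ΦK : CMType K)
    (hk : Module.finrank ℚ k = 2) (he : IsEmpty (k →+* K)) :
    typeRank (ℂ ≃+* ℂ) {z : (Σ _ : Fin 1, (k →+* ℂ)) ⊕ (Σ _ : Fin 1, (K →+* ℂ)) |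
        Sum.elim (· ∈ CMAlgebra.familyType (fun _ : Fin 1 => Φk))
          (· ∈ CMAlgebra.familyType (fun _ : Fin 1 => ΦK)) z} + 1 =
      CMAlgebra.cmFamilyRank (fun _ : Fin 1 => Φk) + CMAlgebra.cmFamilyRank (fun _ : Fin 1 => ΦK) := by
  classical
  -- the glued two-slot family over `Fin 1 ⊕ Fin 1`
  letI instF : ∀ j, Field (Sum.elim (fun _ : Fin 1 => k) (fun _ : Fin 1 => K) j) := fun j =>
    Sum.rec (motive := fun j => Field (Sum.elim (fun _ : Fin 1 => k) (fun _ : Fin 1 => K) j))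
      (fun _ => inferInstanceAs (Field k)) (fun _ => inferInstanceAs (Field K)) j
  letI instN : ∀ j, NumberField (Sum.elim (fun _ : Fin 1 => k) (fun _ : Fin 1 => K) j) := fun j =>
    Sum.rec (motive := fun j => NumberField (Sum.elim (fun _ : Fin 1 => k) (fun _ : Fin 1 => K) j))
      (fun _ => inferInstanceAs (NumberField k)) (fun _ => inferInstanceAs (NumberField K)) j
  haveI instC : ∀ j, IsCMField (Sum.elim (fun _ : Fin 1 => k) (fun _ : Fin 1 => K) j) := fun j =>
    Sum.rec (motive := fun j => IsCMField (Sum.elim (fun _ : Fin 1 => k) (fun _ : Fin 1 => K) j))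
      (fun _ => inferInstanceAs (IsCMField k)) (fun _ => inferInstanceAs (IsCMField K)) j
  let ΦJ : ∀ j, CMType (Sum.elim (fun _ : Fin 1 => k) (fun _ : Fin 1 => K) j) := fun j =>
    Sum.rec (motive := fun j => CMType (Sum.elim (fun _ : Fin 1 => k) (fun _ : Fin 1 => K) j))
      (fun _ => Φk) (fun _ => ΦK) j
  -- §1 for the glued family: the quadratic slot `inl 0` is FOREIGN to the slot `inr 0`, so the two character
  -- modules have no common constituent (both orders) — `U(Φ_k)` is `χ`-isotypic for the sign character `χ` of
  -- `Hom(k, ℂ) = {u₀, ū₀}`, while `ℚ^{Hom(K, ℂ)}` has no `χ`-eigenvector: the stabiliser of `Hom(k, ℂ)` (where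
  -- `χ = 1`) is transitive on `Hom(K, ℂ)` (`exists_ringEquiv_smul_eq_of_isEmpty`), so an eigenvector is constant,
  -- and `χ(ρ) = -1` kills the constant (Moonen–Zarhin Cor. (3.9), proof; Gordon §3 Theorem, proof).
  obtain ⟨u₀⟩ : Nonempty (k →+* ℂ) := inferInstance
  have hne : (starRingAut : ℂ ≃+* ℂ) • u₀ ≠ u₀ := (isCMTypeWith_conj Φk).rho_smul_ne u₀
  have hnc := pairwise_of_eigenvector (G := ℂ ≃+* ℂ) (Φ := fun j => (ΦJ j).1) (i := Sum.inl 0) (j := Sum.inr 0)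
    (fun g => if g • u₀ = u₀ then (1 : ℚ) else -1)
    (fun f hf g => comp_smul_eq_sign_smul_of_finrank_eq_two ΦJ (a := Sum.inl 0) hk u₀ hf g)
    (fun f _ heig => eq_zero_of_eigen_of_transitive (fun g : ℂ ≃+* ℂ => if g • u₀ = u₀ then (1 : ℚ) else -1)
      heig (fun x y => by
        obtain ⟨τ, hτu, hτx⟩ := exists_ringEquiv_smul_eq_of_isEmpty hk he x y
        exact ⟨τ, by simp only [hτu u₀, if_true], hτx⟩)
      (g₀ := (starRingAut : ℂ ≃+* ℂ)) (by simp only [hne, if_false]; norm_num))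
  -- the pairwise criterion for the glued family
  have hpair := fun (i j : Fin 1 ⊕ Fin 1) (hij : i ≠ j) =>
    (show (∀ P : Submodule ℚ ((Sum.elim (fun _ : Fin 1 => k) (fun _ : Fin 1 => K) i →+* ℂ) → ℚ),
        P ≤ antiSpan (ℂ ≃+* ℂ) ((fun j => (ΦJ j).1) i) →
        (∀ g : ℂ ≃+* ℂ, ∀ f ∈ P, (fun x => f (g • x)) ∈ P) →
        ∀ T : ((Sum.elim (fun _ : Fin 1 => k) (fun _ : Fin 1 => K) i →+* ℂ) → ℚ) →ₗ[ℚ]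
            ((Sum.elim (fun _ : Fin 1 => k) (fun _ : Fin 1 => K) j →+* ℂ) → ℚ),
          (∀ g : ℂ ≃+* ℂ, ∀ f ∈ P, T (fun x => f (g • x)) = fun y => T f (g • y)) →
          (∀ f ∈ P, T f ∈ antiSpan (ℂ ≃+* ℂ) ((fun j => (ΦJ j).1) j)) → (∀ f ∈ P, T f = 0 → f = 0) →
          P = ⊥) from by
      rcases i with i | i <;> rcases j with j | j
      · exact absurd (congrArg Sum.inl (Subsingleton.elim i j)) hij
      · obtain rfl : i = 0 := Subsingleton.elim _ _
        obtain rfl : j = 0 := Subsingleton.elim _ _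
        exact hnc.1
      · obtain rfl : i = 0 := Subsingleton.elim _ _
        obtain rfl : j = 0 := Subsingleton.elim _ _
        exact hnc.2
      · exact absurd (congrArg Sum.inr (Subsingleton.elim i j)) hij)
  have hadd := typeRank_sigmaType_add_card_eq_of_pairwise (G := ℂ ≃+* ℂ) (Φ := fun j => (ΦJ j).1)
    (fun j => isCMTypeWith_conj (ΦJ j)) hpair
  -- bookkeeping: `|Fin 1 ⊕ Fin 1| = 2`, the sum over the two slots
  have hcard : Fintype.card (Fin 1 ⊕ Fin 1) = 2 := by simp
  have hsum : (∑ j : Fin 1 ⊕ Fin 1, typeRank (ℂ ≃+* ℂ) ((fun j => (ΦJ j).1) j)) =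
      typeRank (ℂ ≃+* ℂ) Φk.1 + typeRank (ℂ ≃+* ℂ) ΦK.1 := by
    rw [Fintype.sum_sum_type, Fin.sum_univ_one, Fin.sum_univ_one]
    rfl
  -- the two-block index set versus the glued family: an equivariant bijection
  let e : ((Σ _ : Fin 1, (k →+* ℂ)) ⊕ (Σ _ : Fin 1, (K →+* ℂ))) ≃
      (Σ j : Fin 1 ⊕ Fin 1, (Sum.elim (fun _ : Fin 1 => k) (fun _ : Fin 1 => K) j →+* ℂ)) :=
    { toFun := Sum.elim (fun x => ⟨Sum.inl x.1, x.2⟩) (fun y => ⟨Sum.inr y.1, y.2⟩)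
      invFun := fun z => Sum.rec
        (motive := fun j => (Sum.elim (fun _ : Fin 1 => k) (fun _ : Fin 1 => K) j →+* ℂ) →
          (Σ _ : Fin 1, (k →+* ℂ)) ⊕ (Σ _ : Fin 1, (K →+* ℂ)))
        (fun i s => Sum.inl ⟨i, s⟩) (fun j t => Sum.inr ⟨j, t⟩) z.1 z.2
      left_inv := fun z => by rcases z with ⟨i, s⟩ | ⟨j, t⟩ <;> rfl
      right_inv := fun z => by
        obtain ⟨j, s⟩ := z
        rcases j with i | j <;> rfl }
  have hpre : e ⁻¹' CMAlgebra.familyType ΦJ =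
      {z : (Σ _ : Fin 1, (k →+* ℂ)) ⊕ (Σ _ : Fin 1, (K →+* ℂ)) |
        Sum.elim (· ∈ CMAlgebra.familyType (fun _ : Fin 1 => Φk))
          (· ∈ CMAlgebra.familyType (fun _ : Fin 1 => ΦK)) z} := by
    ext z
    rcases z with ⟨i, s⟩ | ⟨j, t⟩ <;> rfl
  have hglue : typeRank (ℂ ≃+* ℂ) {z : (Σ _ : Fin 1, (k →+* ℂ)) ⊕ (Σ _ : Fin 1, (K →+* ℂ)) |
        Sum.elim (· ∈ CMAlgebra.familyType (fun _ : Fin 1 => Φk))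
          (· ∈ CMAlgebra.familyType (fun _ : Fin 1 => ΦK)) z} =
      typeRank (ℂ ≃+* ℂ) (sigmaType fun j => (ΦJ j).1) := by
    rw [← hpre]
    refine (typeRank_preimage_eq (G := ℂ ≃+* ℂ) (G' := ℂ ≃+* ℂ) (CMAlgebra.familyType ΦJ) e
      (fun τ => ⟨τ, fun z => ?_⟩) (fun τ => ⟨τ, fun z => ?_⟩)).trans ?_
    · rcases z with ⟨i, s⟩ | ⟨j, t⟩ <;> rfl
    · rcases z with ⟨i, s⟩ | ⟨j, t⟩ <;> rfl
    · rfl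
  -- one-member families: `cmFamilyRank (Φ) = rank Φ`
  have hk1 : CMAlgebra.cmFamilyRank (fun _ : Fin 1 => Φk) = typeRank (ℂ ≃+* ℂ) Φk.1 :=
    typeRank_preimage_eq_of_surjective (G := ℂ ≃+* ℂ) Φk.1 (fun x : (Σ _ : Fin 1, (k →+* ℂ)) => x.2)
      (fun _ _ => rfl) (fun s => ⟨⟨0, s⟩, rfl⟩)
  have hK1 : CMAlgebra.cmFamilyRank (fun _ : Fin 1 => ΦK) = typeRank (ℂ ≃+* ℂ) ΦK.1 :=
    typeRank_preimage_eq_of_surjective (G := ℂ ≃+* ℂ) ΦK.1 (fun x : (Σ _ : Fin 1, (K →+* ℂ)) => x.2)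
      (fun _ _ => rfl) (fun s => ⟨⟨0, s⟩, rfl⟩)
  rw [hcard, hsum] at hadd
  rw [hglue, hk1, hK1]
  omega

end RankAdditivity

/-! ### §3 A simple abelian surface with CM by `K` forces `k ↪̸ K` for every quadratic CM field `k` -/

section Quartic

variable {k K : Type} [Field k] [NumberField k] [Field K] [NumberField K] [IsCMField K]
  {Φ : CMType K} {A : AbelianVariety ℂ} {ι : 𝓞 K →+* End A} {θ : K →+* Module.End ℂ (complexBetti A.X 1)}

/-- **An embedding of a quadratic CM field into the quartic CM field `K` makes every abelian surface with CM by
`K` NON-simple.**  Along `e : k ↪ K` the type `Φ_k^K = {σ | σ ∘ e ∈ Φ_k}` of `K` induced from a CM type `Φ_k`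
of `k` is imprimitive (`[K:k] = 2` extensions of one embedding have the same pattern,
`exists_ne_of_inducedCMType`); for a QUARTIC CM field primitivity depends on the field only (Shimura §8.4
Example (2)(A)–(C), the tree's `isPrimitive_iff_isPrimitive`), so the type `Φ` of `A` is imprimitive too, and `A` is
not simple (Shimura §8.2 Prop. 26).  Moonen–Zarhin: «the center of `End⁰(X₂)` does not contain an imaginary
quadratic field» for a simple abelian surface `X₂`. [cite: MoonenZarhin1999LowDim, (5.2) and §4]
[cite: Shimura1998, §8.4 Example (2) and §8.2 Prop. 26] -/
theorem not_isSimple_of_isCMTypeRealisation_of_ringHom (Φk : CMType k) (hk : Module.finrank ℚ k = 2)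
    (hK : Module.finrank ℚ K = 4) (e : k →+* K) (hA : IsCMTypeRealisation Φ A ι θ) : ¬ A.IsSimple := by
  obtain ⟨s, t, hst, hpat⟩ := exists_ne_of_inducedCMType e Φk (by rw [hk, hK]; norm_num)
  obtain ⟨φ₀⟩ : Nonempty (K →+* ℂ) := inferInstance
  have h1 : ¬ IsPrimitive (ℂ ≃+* ℂ) (inducedCMType e Φk).1 φ₀ := fun h =>
    hst ((isPrimitive_ringEquiv_complex_iff (inducedCMType e Φk) φ₀).1 h s t hpat)
  rw [isPrimitive_iff_isPrimitive hK (inducedCMType e Φk) Φ φ₀ φ₀] at h1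
  exact not_isSimple_of_isCMTypeRealisation_of_not_isPrimitive hA φ₀ h1

/-- **A SIMPLE abelian surface with CM by `K` admits no embedding `k ↪ K` of a quadratic field carrying a CM type**
(contrapositive of `not_isSimple_of_isCMTypeRealisation_of_ringHom`). [cite: MoonenZarhin1999LowDim, (5.2) and §4]
[cite: Shimura1998, §8.4 Example (2)] -/
theorem isEmpty_ringHom_of_isSimple_of_isCMTypeRealisation (Φk : CMType k) (hk : Module.finrank ℚ k = 2)
    (hK : Module.finrank ℚ K = 4) (hA : IsCMTypeRealisation Φ A ι θ) (hs : A.IsSimple) :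
    IsEmpty (k →+* K) :=
  ⟨fun e => not_isSimple_of_isCMTypeRealisation_of_ringHom Φk hk hK e hA hs⟩

end Quartic

/-! ### §4 `E_k × S`, `S` a simple CM surface: product span on all `E^{N+1} × S^{N+1}`, condition (D) -/

section CMRow

variable {E S : AbelianVariety ℂ}

/-- **Moonen–Zarhin Prop. (3.8) with (5.2), CM case, on all powers**: for `E` an elliptic curve of CM type and
`S` a SIMPLE abelian surface of CM type, every rational Hodge class on `E^{N+1} × S^{N+1}` is a `ℂ`-combination
of exterior products of rational Hodge classes of the two factors (`Hg(E × S) = Hg(E) × Hg(S)`, read through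
Moonen–Zarhin (3.1)).  `E ∼ E'`, `S ∼ S'` realisations of CM types of an imaginary quadratic `k` and a quartic
`K` (`Milne1999.exists_isCMTyped_isIsogenous_of_isSimple`); `S'` simple ⟹ `k ↪̸ K` (§3) ⟹ rank additivity (§2)
⟹ product span for all products of copies (`hodgeClassesProductSpan_of_isIsogenous_biproduct_slots_of_typeRank_add`),
transported along `E^{N+1} ∼ ⨁_{N+1} E'`, `S^{N+1} ∼ ⨁_{N+1} S'`. [cite: MoonenZarhin1999LowDim, Prop. (3.8), (5.2) and §3 (3.1)]
[cite: vanGeemen1994HodgeAV, §3.6 (p. 236)] -/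
theorem hodgeClassesProductSpan_powSucc_cmCurve_powSucc_of_isSimple_surface_of_isOfCMType (hE : E.dim = 1)
    (hEcm : IsOfCMType E) (hS : S.IsSimple) (hS2 : S.dim = 2) (hScm : IsOfCMType S) (N : ℕ) :
    HodgeClassesProductSpan (E.powSucc N) (S.powSucc N) := by
  -- CM-typed models of `E` and `S`
  obtain ⟨E', hE't, hEE'⟩ :=
    exists_isCMTyped_isIsogenous_of_isSimple E (isSimple_of_dim_le_one hE.le) (by omega) hEcm
  obtain ⟨S', hS't, hSS'⟩ := exists_isCMTyped_isIsogenous_of_isSimple S hS (by omega) hScm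
  obtain ⟨Φk, _, ιE, θE, hE'⟩ := hE't
  rename_i k _ _ _
  obtain ⟨ΦK, _, ιS, θS, hS'⟩ := hS't
  rename_i K _ _ _
  -- degrees `[k : ℚ] = 2`, `[K : ℚ] = 4`
  have hdE : E'.dim = 1 := by
    obtain ⟨f, hf⟩ := hEE'
    rw [← dim_eq_of_isIsogeny hf, hE]
  have hdS : S'.dim = 2 := by
    obtain ⟨f, hf⟩ := hSS'
    rw [← dim_eq_of_isIsogeny hf, hS2]
  have hk : Module.finrank ℚ k = 2 := by rw [finrank_eq_two_mul_dim_of_isCMTypeRealisation hE', hdE]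
  have hK : Module.finrank ℚ K = 4 := by rw [finrank_eq_two_mul_dim_of_isCMTypeRealisation hS', hdS]
  -- `S'` is simple, so `k` does not embed in `K`
  have he : IsEmpty (k →+* K) :=
    isEmpty_ringHom_of_isSimple_of_isCMTypeRealisation Φk hk hK hS' (hS.of_isIsogenous hSS')
  -- rank additivity and the product-span property on all products of copies
  exact hodgeClassesProductSpan_of_isIsogenous_biproduct_slots_of_typeRank_add
    (K := fun _ : Fin 1 => k) (K' := fun _ : Fin 1 => K) (Φ := fun _ => Φk) (Φ' := fun _ => ΦK)
    (A := fun _ => E') (A' := fun _ => S') (fun _ => hE') (fun _ => hS')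
    (typeRank_sum_add_one_eq_of_finrank_eq_two_of_isEmpty Φk ΦK hk he)
    (fun _ : Fin (N + 1) => (0 : Fin 1)) (fun _ : Fin (N + 1) => (0 : Fin 1))
    ((isIsogenous_powSucc hEE' N).trans (isIsogenous_powSucc_biproduct E' N))
    ((isIsogenous_powSucc hSS' N).trans (isIsogenous_powSucc_biproduct S' N))

/-- **THE ROW R19 — Moonen–Zarhin Thm. 0.1 (4) for `E_k × S`: an elliptic curve of CM type times a SIMPLE abelian
surface of CM type is stably nondegenerate** (`B = D` on all powers): product span on every `E^{N+1} × S^{N+1}`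
(previous theorem) and condition (D) for `E` (`EllipticCurve.isStablyNondegenerate`) and for `S`
(`AbelianVariety.isStablyNondegenerate_of_isSimple_surface`), glued by
`isStablyNondegenerate_prod_of_forall_productSpan_powSucc`. [cite: MoonenZarhin1999LowDim, Thm. 0.1 (4), Prop. (3.8) and (5.2)]
[cite: Gordon1999HodgeAVSurvey, Thm. 7.5 (1) and Def. 7.6] -/
theorem isStablyNondegenerate_cmCurve_prod_of_isSimple_surface_of_isOfCMType (hE : E.dim = 1)
    (hEcm : IsOfCMType E) (hS : S.IsSimple) (hS2 : S.dim = 2) (hScm : IsOfCMType S) :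
    IsStablyNondegenerate (E.prod S) :=
  isStablyNondegenerate_prod_of_forall_productSpan_powSucc E S
    (hodgeClassesProductSpan_powSucc_cmCurve_powSucc_of_isSimple_surface_of_isOfCMType hE hEcm hS hS2 hScm)
    (EllipticCurve.isStablyNondegenerate hE) (AbelianVariety.isStablyNondegenerate_of_isSimple_surface S hS hS2)

/-- `B = D` on every power `(E × S)^{N+1}`, `E` a CM elliptic curve, `S` a simple CM surface.
[cite: MoonenZarhin1999LowDim, Thm. 0.1 (4)] -/
theorem isDivisorGenerated_powSucc_cmCurve_prod_of_isSimple_surface_of_isOfCMType (hE : E.dim = 1)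
    (hEcm : IsOfCMType E) (hS : S.IsSimple) (hS2 : S.dim = 2) (hScm : IsOfCMType S) (N : ℕ) :
    IsDivisorGenerated ((E.prod S).powSucc N) :=
  isStablyNondegenerate_cmCurve_prod_of_isSimple_surface_of_isOfCMType hE hEcm hS hS2 hScm N

/-- The Hodge conjecture for every power `(E × S)^{N+1}`, `E` a CM elliptic curve, `S` a simple CM surface —
unconditionally (no HC_CM). [cite: MoonenZarhin1999LowDim, Thm. 0.1 (4)] [cite: vanGeemen1994HodgeAV, §2.4 and Lemma 3.7] -/
theorem hodgeConjectureFor_powSucc_cmCurve_prod_of_isSimple_surface_of_isOfCMType (hE : E.dim = 1)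
    (hEcm : IsOfCMType E) (hS : S.IsSimple) (hS2 : S.dim = 2) (hScm : IsOfCMType S) (N : ℕ) :
    HodgeConjectureFor ((E.prod S).powSucc N).dim ((E.prod S).powSucc N).X :=
  (isStablyNondegenerate_cmCurve_prod_of_isSimple_surface_of_isOfCMType hE hEcm hS hS2 hScm).hodgeConjectureFor_powSucc N

end CMRow

/-! ### §5 Every elliptic curve times every abelian surface is stably nondegenerate -/

section Threefolds

variable {E S : AbelianVariety ℂ}

/-- **An elliptic curve times a SIMPLE abelian surface is stably nondegenerate** — all cases: both of CM type
(§4), otherwise `isStablyNondegenerate_curve_prod_of_isSimple_surface_of_not_and_isOfCMType` (programmes R16/R15).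
[cite: MoonenZarhin1999LowDim, Thm. 0.1 (4) and (5.2)] -/
theorem isStablyNondegenerate_curve_prod_simple_surface (hE : E.dim = 1) (hS : S.IsSimple) (hS2 : S.dim = 2) :
    IsStablyNondegenerate (E.prod S) := by
  by_cases h : IsOfCMType E ∧ IsOfCMType S
  · exact isStablyNondegenerate_cmCurve_prod_of_isSimple_surface_of_isOfCMType hE h.1 hS hS2 h.2
  · exact isStablyNondegenerate_curve_prod_of_isSimple_surface_of_not_and_isOfCMType hE hS hS2 h

/-- **EVERY elliptic curve times EVERY abelian surface is stably nondegenerate** (`S` simple: the previous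
theorem; `S` not simple: `isStablyNondegenerate_curve_prod_surface_of_not_isSimple`, Tate / van Geemen Thm. 4.3).
[cite: MoonenZarhin1999LowDim, Thm. 0.1 (4) and (5.2)] [cite: vanGeemen1994HodgeAV, Thm. 4.3] -/
theorem isStablyNondegenerate_curve_prod_surface (hE : E.dim = 1) (hS2 : S.dim = 2) :
    IsStablyNondegenerate (E.prod S) := by
  by_cases hS : S.IsSimple
  · exact isStablyNondegenerate_curve_prod_simple_surface hE hS hS2
  · exact isStablyNondegenerate_curve_prod_surface_of_not_isSimple hE hS2 hS

end Threefolds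

end Literature.AlgebraicGeometry.HodgeTheory

end
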